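import Summits.Schanuel.Schanuel.Theorems.ZilberEacPlaneCurvePolyFibres
import Summits.Schanuel.Schanuel.Theorems.ZilberEacSteepestEdgePlaces
import HarnessLib

/-!
# Arbitrary base branches, LXV: the steepest edge at infinity of a NON-MONIC irreducible plane
# curve — places with both coordinates unbounded exist iff some row is longer than the leading
# row; the row-degree criterion without monicity

HONEST FRAMING.  Cell `pub-schanuel` (Zilber's Exponential-Algebraic Closedness, case ladder;
host summit Schanuel), seat 2, gen 31.  File LX (b) for a general `F ∈ ℂ[x₀][x₁]` of `x₁`-degree
`n ≥ 1` with leading row `a = f_n` of degree `d`: the supporting line through the vertex `(d, n)`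
is `ki + Mj = dk + Mn`;
* **`exists_place_of_edgeRoot'`** — if `k·deg f_j ≤ dk + M(n - j)` for all `j < n`, every root `θ`
  of `E(t) = Σ_{k deg f_j = dk + M(n-j)} lc(f_j) t^j` is `Φ(0)` for a place `x₀ = s^{-ek}`,
  `x₁ = Φ(s)s^{-eM}` of `F = 0`;
* **`exists_place_of_steepestEdge'`** — equality at some `j < n` with `f_j ≠ 0` gives `θ ≠ 0`;
* **`exists_place_atInfinity_of_longRow`** — if SOME row `f_j` (`j < n`) has `deg f_j > deg f_n`,
  the curve has a place at infinity `x₀ = s^{-k}`, `x₁ = Φ(s)s^{-M}` with `k, M ≥ 1`, `Φ(0) ≠ 0`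
  (for monic `F` this is file LX (b); `x₀x₁² = 1` has no such row and no such place);
* **`unprojectedDensityQuestion_planeCurve_polyFibre_of_edgeRoot'`** /
  **`…_of_steepestEdge_not_dvd'`** — Mantova–Masser's question for `{F = 0, y₀ = R}`, `F`
  irreducible of `x₁`-degree `≥ 2`, decided from the row degrees (and, when `k ∣ 2M`, one root of
  the edge polynomial with a good direction), for every `R` nonzero somewhere on the curve.
Decided instances of an OPEN question (Mantova–Masser, PLMS 2024 §1 p. 5); EC(3,2) OPEN; NOT
Schanuel's conjecture (neither used nor implied); EAC ⇏ SC.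
-/

noncomputable section

open Filter Topology Set Complex Polynomial
open Literature.NumberTheory.Transcendental Literature.ModelTheory.Zilber
open Literature.ModelTheory.ExponentialFields

set_option linter.dupNamespace false

namespace Summit.Schanuel.Schanuel.Theorems

section PlaneCurveEdge

variable (F : ℂ[X][X])

/-! ## Part A. Places from the edge through the vertex `(deg f_n, n)` -/

/-- **A place from a root of the edge polynomial, non-monic.**  `F` of `x₁`-degree `n ≥ 1` with a
Bézout element, leading row of degree `d`; weights `(k, M)`, `k ≥ 1`, with
`k·deg f_j ≤ dk + M(n - j)` for all `j < n`; `E(t) = Σ_{k deg f_j = dk + M(n-j)} lc(f_j) t^j`: every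
root `θ` of `E` is `Φ(0)` for a place `x₀ = s^{-ek}`, `x₁ = Φ(s)s^{-eM}` of `F = 0`.
[folklore (Newton–Puiseux at infinity)] (new in this form) -/
theorem exists_place_of_edgeRoot' (hn : 1 ≤ F.natDegree)
    (hbez : ∃ (A B : ℂ[X][X]) (r : ℂ[X]), r ≠ 0 ∧ A * F + B * derivative F = Polynomial.C r)
    {k M : ℕ} (hk : 1 ≤ k)
    (hmax : ∀ j, j < F.natDegree →
      (F.coeff j).natDegree * k ≤ F.leadingCoeff.natDegree * k + M * (F.natDegree - j))
    {E : ℂ[X]} (hE : ∀ j, E.coeff j =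
      if (F.coeff j).natDegree * k = F.leadingCoeff.natDegree * k + M * (F.natDegree - j)
        then (F.coeff j).leadingCoeff else 0)
    {θ : ℂ} (hEθ : E.IsRoot θ) :
    ∃ (e : ℕ) (Φ : ℂ → ℂ), 1 ≤ e ∧ AnalyticAt ℂ Φ 0 ∧ Φ 0 = θ ∧
      ∀ᶠ s in 𝓝[≠] (0 : ℂ),
        (F.map (Polynomial.evalRingHom (s ^ (e * k))⁻¹)).eval (Φ s * (s ^ (e * M))⁻¹) = 0 := by
  classical
  have hk0 : 0 < k := hk
  have hF0 : F ≠ 0 := Polynomial.ne_zero_of_natDegree_gt hn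
  set n := F.natDegree with hn'
  set d := F.leadingCoeff.natDegree with hd
  have hFn : F.coeff n = F.leadingCoeff := rfl
  -- the bound holds for all `j ≤ n`
  have hmax' : ∀ j, j ≤ n → (F.coeff j).natDegree * k ≤ d * k + M * (n - j) := by
    intro j hj
    rcases hj.lt_or_eq with hj' | hj'
    · exact hmax j hj'
    · rw [hj', hFn, Nat.sub_self, mul_zero, add_zero]
  set W : ℂ[X][X] := (F.map (Polynomial.expand ℂ k : ℂ[X] →ₐ[ℂ] ℂ[X]).toRingHom).comp
    (Polynomial.C (X ^ M : ℂ[X]) * X) with hW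
  have hWc : ∀ j, W.coeff j = Polynomial.expand ℂ k (F.coeff j) * X ^ (M * j) :=
    coeff_weightedSubst F k M
  -- the rows of `W` have degree `≤ dk + Mn`
  have hN : ∀ j, (W.coeff j).natDegree ≤ d * k + M * n := by
    intro j
    rw [hWc]
    by_cases hj0 : F.coeff j = 0
    · rw [hj0, map_zero, zero_mul, Polynomial.natDegree_zero]; exact Nat.zero_le _
    rcases Nat.lt_or_ge n j with hj | hj
    · exact absurd (Polynomial.coeff_eq_zero_of_natDegree_lt hj) hj0
    · calc (Polynomial.expand ℂ k (F.coeff j) * X ^ (M * j)).natDegree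
            ≤ (Polynomial.expand ℂ k (F.coeff j)).natDegree + (X ^ (M * j) : ℂ[X]).natDegree :=
            Polynomial.natDegree_mul_le
        _ = (F.coeff j).natDegree * k + M * j := by
            rw [Polynomial.natDegree_expand, Polynomial.natDegree_X_pow]
        _ ≤ d * k + M * (n - j) + M * j := by have := hmax' j hj; omega
        _ = d * k + M * n := by rw [add_assoc, ← mul_add, Nat.sub_add_cancel hj]
  -- the top row of `W` is `E`
  have hT : ∀ j, E.coeff j = (W.coeff j).coeff (d * k + M * n) := by
    intro j
    rw [hE, hWc]
    by_cases hj0 : F.coeff j = 0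
    · simp [hj0]
    rcases Nat.lt_or_ge n j with hj | hj
    · exact absurd (Polynomial.coeff_eq_zero_of_natDegree_lt hj) hj0
    · have hsub : d * k + M * n - M * j = d * k + M * (n - j) := by
        conv_lhs => rw [← Nat.sub_add_cancel hj, mul_add, ← add_assoc, Nat.add_sub_cancel]
      have hle : M * j ≤ d * k + M * n := (Nat.mul_le_mul_left _ hj).trans (Nat.le_add_left _ _)
      rw [Polynomial.coeff_mul_X_pow', if_pos hle, hsub, Polynomial.coeff_expand hk0]
      by_cases heq : (F.coeff j).natDegree * k = d * k + M * (n - j)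
      · have hdvd : k ∣ d * k + M * (n - j) := ⟨(F.coeff j).natDegree, by rw [← heq, mul_comm]⟩
        have hdiv : (d * k + M * (n - j)) / k = (F.coeff j).natDegree :=
          Nat.div_eq_of_eq_mul_left hk0 heq.symm
        rw [if_pos heq, if_pos hdvd, hdiv, Polynomial.leadingCoeff]
      · rw [if_neg heq]
        split_ifs with hdvd
        · obtain ⟨c, hc⟩ := hdvd
          rw [hc, Nat.mul_div_cancel_left _ hk0]
          refine (Polynomial.coeff_eq_zero_of_natDegree_lt ?_).symm
          have hle' := hmax' j hj
          rw [hc] at hle' heq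
          by_contra hlt
          push Not at hlt
          have : (F.coeff j).natDegree = c := by
            refine le_antisymm ?_ hlt
            exact Nat.le_of_mul_le_mul_right (by rwa [mul_comm k c] at hle') hk0
          exact heq (by rw [this, mul_comm])
        · rfl
  have hE0 : E ≠ 0 := by
    intro h
    have h1 := hE n
    rw [h, Polynomial.coeff_zero, hFn, Nat.sub_self, mul_zero, add_zero, if_pos rfl] at h1
    exact (Polynomial.leadingCoeff_ne_zero.2 (Polynomial.leadingCoeff_ne_zero.2 hF0)) h1.symm
  exact exists_place_of_weightedTopRow F hbez hk M W (fun s t => eval_weightedSubst F k M s t)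
    (d * k + M * n) hN E hT hE0 hEθ

/-- **The steepest edge has a nonzero root, non-monic**: with `hmax` as above and equality at
some `j < n` with `f_j ≠ 0`, there is `θ ≠ 0` with a place `x₀ = s^{-ek}`, `x₁ = Φ(s)s^{-eM}`,
`Φ(0) = θ`. [folklore (Newton–Puiseux at infinity)] (new in this form) -/
theorem exists_place_of_steepestEdge' (hn : 1 ≤ F.natDegree)
    (hbez : ∃ (A B : ℂ[X][X]) (r : ℂ[X]), r ≠ 0 ∧ A * F + B * derivative F = Polynomial.C r)
    {k M : ℕ} (hk : 1 ≤ k)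
    (hmax : ∀ j, j < F.natDegree →
      (F.coeff j).natDegree * k ≤ F.leadingCoeff.natDegree * k + M * (F.natDegree - j))
    (hatt : ∃ j, j < F.natDegree ∧ F.coeff j ≠ 0 ∧
      (F.coeff j).natDegree * k = F.leadingCoeff.natDegree * k + M * (F.natDegree - j)) :
    ∃ (θ : ℂ) (e : ℕ) (Φ : ℂ → ℂ), θ ≠ 0 ∧ 1 ≤ e ∧ AnalyticAt ℂ Φ 0 ∧ Φ 0 = θ ∧
      ∀ᶠ s in 𝓝[≠] (0 : ℂ),
        (F.map (Polynomial.evalRingHom (s ^ (e * k))⁻¹)).eval (Φ s * (s ^ (e * M))⁻¹) = 0 := by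
  classical
  have hF0 : F ≠ 0 := Polynomial.ne_zero_of_natDegree_gt hn
  set n := F.natDegree with hn'
  set d := F.leadingCoeff.natDegree with hd
  set E : ℂ[X] := ∑ j ∈ Finset.range (n + 1),
    if (F.coeff j).natDegree * k = d * k + M * (n - j) then
      Polynomial.monomial j (F.coeff j).leadingCoeff else 0 with hEdef
  have hE : ∀ j, E.coeff j =
      if (F.coeff j).natDegree * k = d * k + M * (n - j) then (F.coeff j).leadingCoeff else 0 := by
    intro j
    rw [hEdef, Polynomial.finsetSum_coeff]
    have hterm : ∀ i ∈ Finset.range (n + 1),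
        (if (F.coeff i).natDegree * k = d * k + M * (n - i) then
          Polynomial.monomial i (F.coeff i).leadingCoeff else (0 : ℂ[X])).coeff j =
        if i = j then
          (if (F.coeff j).natDegree * k = d * k + M * (n - j) then (F.coeff j).leadingCoeff else 0)
          else 0 := by
      intro i _
      by_cases hij : i = j
      · subst hij
        rw [if_pos rfl]
        split_ifs
        · rw [Polynomial.coeff_monomial, if_pos rfl]
        · rw [Polynomial.coeff_zero]
      · rw [if_neg hij]
        split_ifs
        · rw [Polynomial.coeff_monomial, if_neg hij]
        · rw [Polynomial.coeff_zero]
    rw [Finset.sum_congr rfl hterm, Finset.sum_ite_eq' (Finset.range (n + 1)) j]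
    by_cases hj : j ∈ Finset.range (n + 1)
    · rw [if_pos hj]
    · rw [if_neg hj]
      rw [Finset.mem_range, not_lt] at hj
      have h0 : F.coeff j = 0 := Polynomial.coeff_eq_zero_of_natDegree_lt (by omega)
      rw [h0, Polynomial.leadingCoeff_zero]
      split_ifs <;> rfl
  obtain ⟨j, hj, hj0, hjeq⟩ := hatt
  have hEj : E.coeff j ≠ 0 := by
    rw [hE, if_pos hjeq]
    exact Polynomial.leadingCoeff_ne_zero.2 hj0
  have hEn : E.coeff n ≠ 0 := by
    rw [hE, show F.coeff n = F.leadingCoeff from rfl, Nat.sub_self, mul_zero, add_zero, if_pos rfl]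
    exact Polynomial.leadingCoeff_ne_zero.2 (Polynomial.leadingCoeff_ne_zero.2 hF0)
  obtain ⟨θ, hθ0, hEθ⟩ := exists_isRoot_ne_zero_of_coeff_ne_zero hj.ne hEj hEn
  obtain ⟨e, Φ, he, hΦan, hΦ0, hplace⟩ := exists_place_of_edgeRoot' F hn hbez hk hmax hE hEθ
  exact ⟨θ, e, Φ, hθ0, he, hΦan, hΦ0, hplace⟩

/-- **A row longer than the leading row gives a place with both coordinates unbounded.**  `F`
irreducible of `x₁`-degree `n ≥ 1`; if `deg f_j > deg f_n` for some `j < n`, the curve `F = 0`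
has a place at infinity `x₀ = s^{-k}`, `x₁ = Φ(s)s^{-M}` with `k, M ≥ 1`, `Φ(0) ≠ 0` (weights
`(n - j⋆, deg f_{j⋆} - deg f_n)` at a row maximising `(deg f_j - deg f_n)/(n - j)`).
[folklore (Newton–Puiseux at infinity)] (new in this form) -/
theorem exists_place_atInfinity_of_longRow (hFirr : Irreducible F) (hn : 1 ≤ F.natDegree)
    (hlong : ∃ j, j < F.natDegree ∧ F.leadingCoeff.natDegree < (F.coeff j).natDegree) :
    ∃ (k M : ℕ) (Φ : ℂ → ℂ), 1 ≤ k ∧ 1 ≤ M ∧ AnalyticAt ℂ Φ 0 ∧ Φ 0 ≠ 0 ∧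
      ∀ᶠ s in 𝓝[≠] (0 : ℂ),
        (F.map (Polynomial.evalRingHom (s ^ k)⁻¹)).eval (Φ s * (s ^ M)⁻¹) = 0 := by
  classical
  set n := F.natDegree with hn'
  set d := F.leadingCoeff.natDegree with hd
  obtain ⟨j₀, hj₀, hj₀deg⟩ := hlong
  obtain ⟨j, hjmem, hjmax⟩ := Finset.exists_max_image (Finset.range n)
    (fun j => (((F.coeff j).natDegree : ℚ) - d) / ((n : ℚ) - j)) ⟨j₀, Finset.mem_range.2 hj₀⟩
  rw [Finset.mem_range] at hjmem
  set k : ℕ := n - j with hk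
  have hk1 : 1 ≤ k := by omega
  have hkq : ((n : ℚ) - j) = (k : ℚ) := by rw [hk, Nat.cast_sub hjmem.le]
  -- the maximum is positive, so `deg f_j > d`
  have hjd : d < (F.coeff j).natDegree := by
    have h := hjmax j₀ (Finset.mem_range.2 hj₀)
    rw [hkq] at h
    have hpos : (0 : ℚ) < (((F.coeff j₀).natDegree : ℚ) - d) / ((n : ℚ) - j₀) := by
      apply div_pos
      · rw [sub_pos]; exact_mod_cast hj₀deg
      · rw [sub_pos]; exact_mod_cast hj₀
    have hq : (0 : ℚ) < (((F.coeff j).natDegree : ℚ) - d) / k := hpos.trans_le h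
    have hk' : (0 : ℚ) < k := by exact_mod_cast hk1
    have := (div_pos_iff_of_pos_right hk').1 hq
    rw [sub_pos] at this
    exact_mod_cast this
  set M : ℕ := (F.coeff j).natDegree - d with hM
  have hM1 : 1 ≤ M := by omega
  have hMq : (M : ℚ) = ((F.coeff j).natDegree : ℚ) - d := by rw [hM, Nat.cast_sub hjd.le]
  have hmax : ∀ i, i < n → (F.coeff i).natDegree * k ≤ d * k + M * (n - i) := by
    intro i hi
    have h := hjmax i (Finset.mem_range.2 hi)
    rw [hkq, ← hMq, show ((n : ℚ) - i) = ((n - i : ℕ) : ℚ) by rw [Nat.cast_sub hi.le],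
      div_le_div_iff₀ (by exact_mod_cast (by omega : 0 < n - i)) (by exact_mod_cast hk1)] at h
    have h' : (((F.coeff i).natDegree : ℚ)) * k ≤ (d : ℚ) * k + (M : ℚ) * ((n - i : ℕ) : ℚ) := by
      linarith
    exact_mod_cast h'
  have hatt : ∃ i, i < n ∧ F.coeff i ≠ 0 ∧ (F.coeff i).natDegree * k = d * k + M * (n - i) := by
    refine ⟨j, hjmem, fun h => ?_, ?_⟩
    · rw [h, Polynomial.natDegree_zero] at hjd
      exact Nat.not_lt_zero _ hjd
    · rw [hM, ← hk, Nat.sub_mul]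
      have : d * k ≤ (F.coeff j).natDegree * k := Nat.mul_le_mul_right _ hjd.le
      omega
  obtain ⟨θ, e, Φ, hθ0, he, hΦan, hΦ0, hplace⟩ :=
    exists_place_of_steepestEdge' F hn (exists_bezout_derivative hFirr (by omega)) hk1 hmax hatt
  refine ⟨e * k, e * M, Φ, Nat.mul_le_mul he hk1, Nat.mul_le_mul he hM1, hΦan, by rw [hΦ0]; exact hθ0,
    hplace⟩

/-! ## Part B. The row-degree criterion without monicity -/

/-- **Steepest edge with a good direction, non-monic.**  `F` irreducible of `x₁`-degree `n ≥ 2`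
with leading row of degree `d`; weights `(k, M)`, `k, M ≥ 1`, `k·deg f_j ≤ dk + M(n - j)` for
`j < n`; `θ` a root of the edge polynomial with `Re(θ z^M) ≠ 0` for some `z^k = 2πi`; `R` nonzero
somewhere on the curve: case ∧ dense. [cite: MantovaMasser2023, §1 Further remarks, p. 5 (the
question, open in general)] (new) -/
theorem unprojectedDensityQuestion_planeCurve_polyFibre_of_edgeRoot' (hFirr : Irreducible F)
    (hn : 2 ≤ F.natDegree) {k M : ℕ} (hk : 1 ≤ k) (hM : 1 ≤ M)
    (hmax : ∀ j, j < F.natDegree →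
      (F.coeff j).natDegree * k ≤ F.leadingCoeff.natDegree * k + M * (F.natDegree - j))
    {E : ℂ[X]} (hE : ∀ j, E.coeff j =
      if (F.coeff j).natDegree * k = F.leadingCoeff.natDegree * k + M * (F.natDegree - j)
        then (F.coeff j).leadingCoeff else 0)
    {θ : ℂ} (hEθ : E.IsRoot θ) (hdir : ∃ z : ℂ, z ^ k = 2 * Real.pi * I ∧ (θ * z ^ M).re ≠ 0)
    (R : MvPolynomial (Fin 2) ℂ)
    (hR : ∃ x y : ℂ, (F.map (Polynomial.evalRingHom x)).eval y = 0 ∧ MvPolynomial.eval ![x, y] R ≠ 0) :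
    MMCaseDimPiOneFree {w : Fin 2 ⊕ Fin 2 → ℂ |
        (F.map (Polynomial.evalRingHom (w (Sum.inl 0)))).eval (w (Sum.inl 1)) = 0 ∧
        w (Sum.inr 0) = MvPolynomial.eval ![w (Sum.inl 0), w (Sum.inl 1)] R} ∧
      UnprojectedDense {w : Fin 2 ⊕ Fin 2 → ℂ |
        (F.map (Polynomial.evalRingHom (w (Sum.inl 0)))).eval (w (Sum.inl 1)) = 0 ∧
        w (Sum.inr 0) = MvPolynomial.eval ![w (Sum.inl 0), w (Sum.inl 1)] R} := by
  obtain ⟨e, Φ, he, hΦan, hΦ0, hplace⟩ := exists_place_of_edgeRoot' F (by omega)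
    (exists_bezout_derivative hFirr (by omega)) hk hmax hE hEθ
  have hdir' := exists_direction_mul he hdir
  rw [← hΦ0] at hdir'
  exact unprojectedDensityQuestion_planeCurve_polyFibre F hFirr hn (Nat.mul_le_mul he hk)
    (Nat.mul_le_mul he hM) hΦan hplace hdir' R hR

/-- **The row-degree criterion, non-monic.**  `F` irreducible of `x₁`-degree `n ≥ 2` with leading
row of degree `d`; weights `(k, M)`, `k ≥ 1`, with `k·deg f_j ≤ dk + M(n - j)` for `j < n`,
equality at some `j < n` with `f_j ≠ 0`, and `k ∤ 2M`: for EVERY `R` nonzero somewhere on the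
curve, `{F = 0, y₀ = R}` is in Mantova–Masser's case and has Zariski-dense exponential points.
[cite: MantovaMasser2023, §1 Further remarks, p. 5 (the question, open in general)] (new) -/
theorem unprojectedDensityQuestion_planeCurve_polyFibre_of_steepestEdge_not_dvd' (hFirr : Irreducible F)
    (hn : 2 ≤ F.natDegree) {k M : ℕ} (hk : 1 ≤ k)
    (hmax : ∀ j, j < F.natDegree →
      (F.coeff j).natDegree * k ≤ F.leadingCoeff.natDegree * k + M * (F.natDegree - j))
    (hatt : ∃ j, j < F.natDegree ∧ F.coeff j ≠ 0 ∧
      (F.coeff j).natDegree * k = F.leadingCoeff.natDegree * k + M * (F.natDegree - j))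
    (hkM : ¬ k ∣ 2 * M) (R : MvPolynomial (Fin 2) ℂ)
    (hR : ∃ x y : ℂ, (F.map (Polynomial.evalRingHom x)).eval y = 0 ∧ MvPolynomial.eval ![x, y] R ≠ 0) :
    MMCaseDimPiOneFree {w : Fin 2 ⊕ Fin 2 → ℂ |
        (F.map (Polynomial.evalRingHom (w (Sum.inl 0)))).eval (w (Sum.inl 1)) = 0 ∧
        w (Sum.inr 0) = MvPolynomial.eval ![w (Sum.inl 0), w (Sum.inl 1)] R} ∧
      UnprojectedDense {w : Fin 2 ⊕ Fin 2 → ℂ |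
        (F.map (Polynomial.evalRingHom (w (Sum.inl 0)))).eval (w (Sum.inl 1)) = 0 ∧
        w (Sum.inr 0) = MvPolynomial.eval ![w (Sum.inl 0), w (Sum.inl 1)] R} := by
  obtain ⟨θ, e, Φ, hθ0, he, hΦan, hΦ0, hplace⟩ := exists_place_of_steepestEdge' F (by omega)
    (exists_bezout_derivative hFirr (by omega)) hk hmax hatt
  have hM : 1 ≤ M := by
    rcases Nat.eq_zero_or_pos M with h | h
    · exact absurd (by rw [h, mul_zero]; exact dvd_zero k) hkM
    · exact h
  have hdir' := exists_direction_mul he (exists_direction_of_not_dvd hk hkM hθ0)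
  rw [← hΦ0] at hdir'
  exact unprojectedDensityQuestion_planeCurve_polyFibre F hFirr hn (Nat.mul_le_mul he hk)
    (Nat.mul_le_mul he hM) hΦan hplace hdir' R hR

end PlaneCurveEdge

end Summit.Schanuel.Schanuel.Theorems

end
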